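import Summits.CriticalPhenomena.PercolationContinuityZ3.Theorems.Transplant.CayleyZ2RotC4SideSteps
import HarnessLib

/-!
# ERRATUM to «CayleyZ2RotC4SideSteps» (p492866), in kernel form: `X′ = Cay(ℤ²⋊C₄; ρ, x, ρxρ⁻¹)` IS the product graph `ℤ² □ C₄`, and the heading shift is a
# chart-preserving automorphism — so `X′` is one-type-able and NOT a new reach (its `θ(p_c) = 0` was V153 clause (5), `K × ℤ²` with `K = ℤ/4`)

builds on p205010 (kernel theorem, internal audit signed; external expert review pending) — nothing in THIS file uses p205010 (pure graph identities).  Lane `prim-bschramm`,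
seat `prim-bschramm-p5` gen 27 (refuter seat correcting its OWN row; bus 2026-08-27 04:00Z (E1), P5-SHARPNESS §59.3).  Helper file (`--supports stmt-CriticalPhenomena-4575 --as helper`);
no node / statement / `@[conjecture]`.  The theorems of p492866 (`Z2RotSide.criticalContinuity`, the four-type aligned skeleton) STAND; only its header's words «first customer of the
multi-type nodes that NO one-type node reaches» / «outside every one-type node» / «first Cayley graph of a group with finite abelianisation» are WITHDRAWN as statements about the GRAPH
(they are true of the PRESENTATION `Cay(ℤ²⋊C₄; ρ, x, ρxρ⁻¹)` only).  RULE adopted lane-wide after this erratum (p3 g28 P3-NILPOTENT §20.7, stmt-g31 p494463): «outside every one-type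
node» needs an Aut-LEVEL reason — a degree/orbit invariant («Z2PeriodicBilayerNonTransitive» `not_vertexTransitive`), an Aut-free no-chart proof («CayleyZ2RotC4NoStepChart»
`Z2Rot.no_singleEdgeStep_chart`), or a computed automorphism group.
* `Z2RotSide.graph_eq_boxProd : Z2RotSide.graph = zdGraph 2 □ SimpleGraph.cycleGraph 4` — at heading `k` the move / side-step displacements `{±ρ^k e₀, ±ρ^{k+1} e₀}` are
  `{±e₀, ±e₁}` for EVERY `k`; the turns are the 4-cycle;
* `Z2RotSide.headingShiftIso : graph ≃g graph`, `(v, k) ↦ (v, k+1)` (= right multiplication by `ρ`, which normalises `{ρ, x, ρxρ⁻¹}`), with `headingShiftIso_fst` (chart preserved):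
  together with the translations `shiftIso` a vertex-transitive chart-translating group `ℤ² × ⟨R_ρ⟩`.
[cite: BenjaminiSchramm1996, §2 (Cayley graphs)] [this work]
-/

noncomputable section

/-! ## The identification and the heading shift

(See the module header.) -/

namespace Summit.CriticalPhenomena.PercolationContinuityZ3.Theorems.Transplant

open Literature.Probability.Percolation Literature.Probability.LatticeModels SimpleGraph
open scoped Classical

namespace Z2RotSide

open Z2Rot (dir dir_ne_zero Vtx)

/-- A signed unit coordinate vector is one of the four displacements available at every heading. [folklore] -/
theorem single_mem_dirs_int (k : Fin 4) (i : Fin 2) {t : ℤ} (ht : t = 1 ∨ t = -1) :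
    Pi.single i t = dir k ∨ Pi.single i t = -dir k ∨ Pi.single i t = dir (k + 1) ∨ Pi.single i t = -dir (k + 1) := by
  rcases ht with rfl | rfl
  · have h := single_mem_dirs k i 1
    rwa [Units.val_one] at h
  · have h := single_mem_dirs k i (-1)
    rwa [Units.val_neg, Units.val_one] at h

/-- **ERRATUM IN KERNEL FORM: `X′ = ℤ² □ C₄`** — the rotor square lattice with side-steps IS the box product of the square lattice `zdGraph 2` with the 4-cycle
`SimpleGraph.cycleGraph 4` (same vertex type `Site 2 × Fin 4`, same edges). [this work] -/
theorem graph_eq_boxProd : graph = zdGraph 2 □ SimpleGraph.cycleGraph 4 := by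
  ext a b
  obtain ⟨a1, a2⟩ := a
  obtain ⟨b1, b2⟩ := b
  rw [SimpleGraph.boxProd_adj]
  -- heading moves are bonds of `ℤ²`
  have hadd : ∀ (v : Site 2) (m : Fin 4), (zdGraph 2).Adj v (v + dir m) := by
    intro v m
    rw [zdGraph_adj_iff]
    fin_cases m
    · exact ⟨0, Or.inl rfl⟩
    · exact ⟨1, Or.inl rfl⟩
    · exact ⟨0, Or.inr (by rw [add_assoc]; ext t; fin_cases t <;> simp [dir])⟩
    · exact ⟨1, Or.inr (by rw [add_assoc]; ext t; fin_cases t <;> simp [dir])⟩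
  have hsub : ∀ (v : Site 2) (m : Fin 4), (zdGraph 2).Adj v (v - dir m) := by
    intro v m
    have := (hadd (v - dir m) m).symm
    rwa [sub_add_cancel] at this
  constructor
  · intro h
    have hb := mem_nbrs_of_adj h
    simp only [nbrs, Finset.mem_insert, Finset.mem_singleton, Prod.mk.injEq] at hb
    rcases hb with ⟨h1, h2⟩ | ⟨h1, h2⟩ | ⟨h1, h2⟩ | ⟨h1, h2⟩ | ⟨h1, h2⟩ | ⟨h1, h2⟩ <;> rw [h1, h2]
    · exact Or.inl ⟨hadd a1 a2, rfl⟩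
    · exact Or.inl ⟨hsub a1 a2, rfl⟩
    · exact Or.inl ⟨hadd a1 (a2 + 1), rfl⟩
    · exact Or.inl ⟨hsub a1 (a2 + 1), rfl⟩
    · exact Or.inr ⟨SimpleGraph.cycleGraph_adj.2 (Or.inr (by rw [add_sub_cancel_left])), rfl⟩
    · exact Or.inr ⟨SimpleGraph.cycleGraph_adj.2 (Or.inl (by rw [sub_sub_cancel])), rfl⟩
  · rintro (⟨hzd, h2⟩ | ⟨hc, h1⟩)
    · have h2' : a2 = b2 := h2
      subst h2'
      obtain ⟨i, hb | hb⟩ := (zdGraph_adj_iff a1 b1).1 hzd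
      · have hb' : b1 = a1 + Pi.single i (1 : ℤ) := hb
        rw [hb']
        exact adj_add_of_mem a1 a2 (single_mem_dirs_int a2 i (Or.inl rfl))
      · have hb' : b1 = a1 + Pi.single i (-1 : ℤ) := by
          have : a1 = b1 + Pi.single i (1 : ℤ) := hb
          rw [this, add_assoc, ← Pi.single_add]; simp
        rw [hb']
        exact adj_add_of_mem a1 a2 (single_mem_dirs_int a2 i (Or.inr rfl))
    · have h1' : a1 = b1 := h1
      subst h1'
      have hc' : a2 - b2 = 1 ∨ b2 - a2 = 1 := SimpleGraph.cycleGraph_adj.1 hc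
      rcases hc' with hc' | hc'
      · have e : b2 = a2 - 1 := by rw [← hc', sub_sub_cancel]
        rw [e]
        exact adj_turn' a1 a2
      · have e : b2 = a2 + 1 := by rw [← hc', add_sub_cancel]
        rw [e]
        exact adj_turn a1 a2

/-- **The heading shift `(v, k) ↦ (v, k + 1)` (right multiplication by `ρ`) is an automorphism of `X′` PRESERVING the chart** — so `ℤ² × ⟨R_ρ⟩` is a vertex-transitive
chart-translating group and the four-type skeleton is one-type-able (the reason the header's 'outside every one-type node' is withdrawn). [this work] -/
def headingShiftIso : graph ≃g graph where
  toEquiv := Equiv.prodCongr (Equiv.refl _) (Equiv.addRight (1 : Fin 4))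
  map_rel_iff' := by
    intro a b
    obtain ⟨a1, a2⟩ := a
    obtain ⟨b1, b2⟩ := b
    show graph.Adj (a1, a2 + 1) (b1, b2 + 1) ↔ graph.Adj (a1, a2) (b1, b2)
    rw [graph_eq_boxProd, SimpleGraph.boxProd_adj, SimpleGraph.boxProd_adj]
    simp only [add_left_inj, SimpleGraph.cycleGraph_adj, add_sub_add_right_eq_sub]

/-- The heading shift preserves the chart `Prod.fst`. [folklore] -/
theorem headingShiftIso_fst (a : Vtx) : (headingShiftIso a).1 = a.1 := rfl

end Z2RotSide

end Summit.CriticalPhenomena.PercolationContinuityZ3.Theorems.Transplant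

end
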